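import Summits.ResolutionOfSingularities.ResolutionOfSingularities.Theorems.EquisingularLiftEquisingularLiftNatInCarrierCurveStep
import Summits.ResolutionOfSingularities.ResolutionOfSingularities.Theorems.EquisingularLiftEquisingularLiftNatSubchainSupplierInvDefs
import Summits.ResolutionOfSingularities.ResolutionOfSingularities.Theorems.EquisingularLiftEquisingularLiftChainRegular
import HarnessLib

/-!
# [OURS · L1 W4.5(b) · EL♮(3)] HSUB(ReachTC⁺) — THE FINAL CLAUSE OF THE DRIVER FROM THE INVARIANT: `TCPlus.Inv ⇒ curve step`
# (registered stub `stub_elnat_tcPlusPointResolution`; driver `hsub_reachTCPlus_of_invariant` p526242, clause (final))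

Crux `EquisingularLiftNat` = stmt-ResolutionOfSingularities-20038 (child EL♮(3) = stmt-ResolutionOfSingularities-20148), route
EquisingularLift, line `sections`. Helper file `--supports stmt-ResolutionOfSingularities-20148 --as helper` by res-L1-w45b-stub-1
(HSUB(ReachTC⁺) assembly). HONEST FRAMING: OURS (cell res-hironaka, slot W4.5(b)); NOT a statement of any manuscript; AI-written,
weaker than expert review. No `sorry`; standard axioms.

* **`curveStep_of_inv`** — the `(final)` interface clause of the driver for `INV := TCPlus.Inv O k θ P q Y Ch`: from the invariant
  at `(G, β, T, Z, b)` with `Z` closed, `Z ⊆ T`, `T ⊄ Z`, and a blow-up `υ : G₂ → G` of `𝓘(Z)`, the full HSUB′ output tuple for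
  `(G₂, closure υ⁻¹(T ∖ Z))`. The member with NO excluded point (`TCPlus.Member … ∅`, clause of `Inv`) supplies the in-carrier
  centre `C = 𝓢 ⊔ K`: exact special fibre (i) (with `closure Z = Z`), flat (ii), regular quotient stalks at every special point (v),
  off the generic point of `Y` (iv); properness of `σ ≫ q` along the chain (`chain_isRegular`); then res-L1-w45b-stub-1
  `curveStep_of_centre` (…NatInCarrierCurveStep p525565). The finiteness of the singular set in the driver's clause is not needed.

References: res-L1-w45b-stub-1 …NatSubchainSupplierDriver (p526242), …NatSubchainSupplierInvDefs (p532383), …NatInCarrierCurveStep.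
-/

set_option linter.dupNamespace false -- mandated namespace `Summit.<Summit>.<Problem>` of this single-conjunct summit
set_option linter.overlappingInstances false -- signatures carry `[IsDomain O] [IsDiscreteValuationRing O]`

noncomputable section

open CategoryTheory CategoryTheory.Limits AlgebraicGeometry TopologicalSpace Topology IsLocalRing
open Literature.AlgebraicGeometry.Resolution
open AlgebraicGeometry.Scheme.IdealSheafData
open Summit.ResolutionOfSingularities.ResolutionOfSingularities.Theses.EquisingularLift.Split
open Summit.ResolutionOfSingularities.ResolutionOfSingularities.Cruxes.EquisingularLift.StrataSplit

namespace Summit.ResolutionOfSingularities.ResolutionOfSingularities.Cruxes.EquisingularLiftNat.Sections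

/-- **`(final)` from the invariant.** `TCPlus.Inv O k θ P q Y Ch W G β T Z b`, `Z` closed, `Z ⊆ T`, `T ⊄ Z`, `υ : G₂ → G` the
blow-up of `𝓘(Z)` ⇒ the next `Ch`-stage `X₂` with its model square over `Spec θ` realising `G₂`, tracking
`closure υ⁻¹(T ∖ Z)` (closed, irreducible), `G₂` integral. [OURS · L1 W4.5b] clause (final) of `hsub_reachTCPlus_of_invariant`
toward `stub_elnat_tcPlusPointResolution`; NOT a statement of the manuscript. -/
theorem curveStep_of_inv (O : Type) [CommRing O] [IsDomain O] [IsDiscreteValuationRing O] (k : Type) [Field k]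
    (θ : O →+* k) (hθ : Function.Surjective θ)
    (P : Scheme.{0}) (q : P ⟶ Spec (.of O)) [IsProper q] (Y : Set P) (hYirr : IsIrreducible Y) (hYcl : IsClosed Y)
    (hPnoeth : IsLocallyNoetherian P) (hPreg : Scheme.IsRegular P)
    (Ch : ∀ X' : Scheme.{0}, (X' ⟶ P) → Set X' → Prop)
    (hChain : ∀ (X' : Scheme.{0}) (σ : X' ⟶ P) (S : Set X'), Ch X' σ S → Chain P Y X' σ S)
    (hStep : ∀ (X' X'' : Scheme.{0}) (σ' : X' ⟶ P) (S' : Set X') (C : X'.IdealSheafData) (τ : X'' ⟶ X'),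
      Ch X' σ' S' → IsBlowup τ C → Scheme.IsRegular C.subscheme → Flat (C.subschemeι ≫ σ' ≫ q) →
      σ' '' (C.support : Set X') ⊆ {x : P | ¬ IsGenericPoint x Y} →
      (C.support : Set X') ∩ (σ' ≫ q) ⁻¹' {IsLocalRing.closedPoint O} ⊆ S' →
      Ch X'' (τ ≫ σ') (closure (τ ⁻¹' (S' \ (C.support : Set X')))))
    {F₁ F₂ : Scheme.{0}} (W : Set F₁) (G : Scheme.{0}) (β : G ⟶ F₂) (T Z : Set G) (b : Bool)
    (hInv : TCPlus.Inv O k θ P q Y Ch W G β T Z b) (hZ : IsClosed Z) (hZT : Z ⊆ T) (hTZ : ¬ T ⊆ Z)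
    (G₂ : Scheme.{0}) (υ : G₂ ⟶ G) (hυ : IsBlowup υ (vanishingIdeal ⟨Z, hZ⟩)) :
    ∃ (X₂ : Scheme.{0}) (σ₂ : X₂ ⟶ P) (S₂ : Set X₂) (j₂ : G₂ ⟶ X₂) (t₂ : G₂ ⟶ Spec (.of k)),
      Ch X₂ σ₂ S₂ ∧ IsIntegral X₂ ∧ IsLocallyNoetherian X₂ ∧ Scheme.IsRegular X₂ ∧ IsDominant (σ₂ ≫ q) ∧
      IsPullback j₂ t₂ (σ₂ ≫ q) (Spec.map (CommRingCat.ofHom θ)) ∧ j₂ '' closure (υ ⁻¹' (T \ Z)) = S₂ ∧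
      IsClosed (closure (υ ⁻¹' (T \ Z))) ∧ IsIrreducible (closure (υ ⁻¹' (T \ Z))) ∧ IsIntegral G₂ := by
  obtain ⟨hGint, -, -, -, hmem, -⟩ := hInv
  obtain ⟨X, σ, S, jG, tG, 𝓢, K, hCh, hXint, hXnoeth, hXreg, hdom, hsq, hTS, hi, hii, -, -, hiv, hv, -⟩ := hmem
  haveI := hGint
  haveI := hXint
  haveI := hXnoeth
  -- `σ ≫ q` is proper along the chain
  obtain ⟨-, -, hσ⟩ := chain_isRegular P Y X σ S (hChain _ _ _ hCh) hPnoeth hPreg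
  haveI := hσ
  haveI : IsProper (σ ≫ q) := inferInstance
  -- the member's clauses in the currency of `curveStep_of_centre`
  have e : (⟨closure Z, isClosed_closure⟩ : Closeds G) = ⟨Z, hZ⟩ := Closeds.ext hZ.closure_eq
  have hCD : (𝓢 ⊔ K).comap jG = vanishingIdeal ⟨Z, hZ⟩ := by rw [← e]; exact hi
  have hCreg : ∀ x ∈ ((𝓢 ⊔ K).support : Set X), (σ ≫ q) x = IsLocalRing.closedPoint O →
      IsRegularLocalRing (X.presheaf.stalk x ⧸ stalkIdeal (𝓢 ⊔ K) x) :=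
    fun x hx hqx => (hv x hx hqx (by simp)).1
  exact curveStep_of_centre O k θ hθ P q Y hYirr hYcl Ch hChain hStep X σ S hCh hXreg hdom G jG tG hsq T hTS Z hZ hZT hTZ
    (𝓢 ⊔ K) hCD hii hCreg hiv G₂ υ hυ

end Summit.ResolutionOfSingularities.ResolutionOfSingularities.Cruxes.EquisingularLiftNat.Sections

end
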